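/-
Copyright (c) 2026. All rights reserved.
Released under Apache 2.0 license as described in the file LICENSE.
Authors: abc-iut cell, wave-2 prover seat abc-iut-L3-t11 (proof-only companion; discharge item G4b of
plan/L3/DISCHARGE-L3.md, part 2).
-/
import Mathlib.Data.Set.Card
import Literature.AnabelianGeometry.SemiGraphs.FreeGroupsAndActionsProofs2
import Literature.AnabelianGeometry.SemiGraphs.SubdivisionPaths

/-!
# [SemiAnbd] Lemma 1.8 (ii)(c): three fixed vertices of a tree give a pointwise-fixed subjoint (proof)

Mochizuki, *Semi-graphs of Anabelioids*, Publ. RIMS **42** (2006) 221–322, §1, author's manuscript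
p. 20, Lemma 1.8 (ii)(c) [cite: MochizukiSemiAnbd2006, Lem. 1.8(ii)(c) p.20]: `G` a tree with an action
of a finite group `Γ`; "if `Γ` fixes three distinct vertices of `G`, then there exists at least one
subjoint of `G` [a sub-semi-graph with one vertex and two edges, both open, connected — p. 13] on which
`Γ` acts trivially."

PROOF-ONLY companion of `FreeGroupsAndActions.lean` (abc-iut-L3-t1, p404224), continuing
`FreeGroupsAndActionsProofs2.lean` ((ii)(b)): `lemma_1_8_ii_c_holds` discharges `SemiGraph.lemma_1_8_ii_c`
AS TYPED. Route: walk along the (unique) path of the barycentric subdivision from `w₁` to `w₂`; its nodes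
follow the pattern vertex – branch – edge – branch – vertex – … (tool file `SubdivisionPaths.lean`:
`path_between_vertices_shape`). Either the path has an interior vertex `v₁` (position 4),
which then carries the two distinct edges at positions 2 and 6, or `w₁`, `w₂` are joined by a single edge;
in the latter case the same dichotomy for `w₂`, `w₃` either gives an interior vertex or makes `w₂` the
middle vertex of two distinct edges `e₁₂ ≠ e₂₃` (one edge cannot abut three distinct vertices). All these
nodes are fixed by (ii)(b) (`nodeMap_eq_self_of_isPath`). The sub-semi-graph `⟨{v}, {e₁, e₂}⟩` is then a
subjoint (in a tree an edge has at most one branch at a given vertex — `branch_unique_of_isAcyclic` — so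
both edges are open in it; it is connected through `v`) on which `Γ` acts trivially (the branch of `eᵢ`
at `v` is fixed by uniqueness, the other branch because `eᵢ` has exactly two). No definitions; nothing
here bears on anything disputed.
-/

namespace Literature.AnabelianGeometry.SemiGraphs

namespace SemiGraph

open CategoryTheory

universe u

variable {G : SemiGraph.{u}}

/-- Adjacency in the subdivision is the symmetrised incidence relation.
[cite: MochizukiSemiAnbd2006, §1 pp.11-12] -/
private theorem adj_iff' {H : SemiGraph.{u}} {x y : H.Node} :
    H.subdivision.Adj x y ↔ x ≠ y ∧ (H.NodeRel x y ∨ H.NodeRel y x) :=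
  SimpleGraph.fromRel_adj _ _ _

/-! ### The subjoint `⟨{v}, {e₁, e₂}⟩` -/

section Subjoint

variable (v : G.Vertex) (e₁ e₂ : G.Edge)

/-- In `H = ⟨{v}, E⟩`, a branch abutting to `v` in `G` abuts to the vertex `v` of `H`.
[cite: MochizukiSemiAnbd2006, §1 p.12] -/
private theorem pair_abuts_eq (E : Set G.Edge) (b : (⟨{v}, E⟩ : G.Subgraph).toSemiGraph.Branch)
    (hb : G.abuts b.1 = some v) :
    (⟨{v}, E⟩ : G.Subgraph).toSemiGraph.abuts b = some ⟨v, rfl⟩ := by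
  change (G.abuts b.1).pbind _ = _
  rw [hb, Option.pbind_some, dif_pos (show v ∈ ({v} : Set G.Vertex) from rfl)]
  rfl

/-- In the sub-semi-graph `H = ⟨{v}, E⟩`, a branch abuts (to the unique vertex) iff it abuts to `v` in `G`.
[cite: MochizukiSemiAnbd2006, §1 p.12] -/
private theorem pair_abuts_isSome_iff (E : Set G.Edge) (b : (⟨{v}, E⟩ : G.Subgraph).toSemiGraph.Branch) :
    ((⟨{v}, E⟩ : G.Subgraph).toSemiGraph.abuts b).isSome ↔ G.abuts b.1 = some v := by
  constructor
  · intro h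
    obtain ⟨w, hw⟩ := Option.isSome_iff_exists.mp h
    have h1 : G.abuts b.1 = some w.1 := (⟨{v}, E⟩ : G.Subgraph).ι.abuts_branchMap b w hw
    have hw2 : w.1 ∈ ({v} : Set G.Vertex) := w.2
    have hw3 : w.1 = v := Set.mem_singleton_iff.mp hw2
    rw [h1, hw3]
  · intro h
    rw [pair_abuts_eq v E b h]
    rfl

/-- **`⟨{v}, {e₁, e₂}⟩` is a subjoint** when `e₁ ≠ e₂` both abut to `v` and the subdivision is acyclic:
one vertex, two edges, each open in it (an edge of a tree has at most one branch at `v`), connected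
through `v`. [cite: MochizukiSemiAnbd2006, §1 p.13] -/
theorem isSubjoint_pair (hG : G.subdivision.IsAcyclic) {v : G.Vertex} {e₁ e₂ : G.Edge} (hne : e₁ ≠ e₂)
    {c₁ c₂ : G.Branch} (hc₁e : G.edgeOf c₁ = e₁) (hc₁v : G.abuts c₁ = some v) (hc₂e : G.edgeOf c₂ = e₂)
    (hc₂v : G.abuts c₂ = some v) : (⟨{v}, {e₁, e₂}⟩ : G.Subgraph).IsSubjoint := by
  set H : G.Subgraph := ⟨{v}, {e₁, e₂}⟩ with hH
  -- the distinguished nodes of `H`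
  let V : H.toSemiGraph.Node := Sum.inl ⟨v, rfl⟩
  have reachE : ∀ e : H.toSemiGraph.Edge, H.toSemiGraph.subdivision.Reachable V (Sum.inr (Sum.inl e)) := by
    intro e
    -- pick the branch of `e` at `v`
    have he0 : e.1 ∈ ({e₁, e₂} : Set G.Edge) := e.2
    have he : e.1 = e₁ ∨ e.1 = e₂ := by
      rcases Set.mem_insert_iff.mp he0 with h | h
      · exact Or.inl h
      · exact Or.inr (Set.mem_singleton_iff.mp h)
    obtain ⟨c, hce, hcv⟩ : ∃ c : G.Branch, G.edgeOf c = e.1 ∧ G.abuts c = some v := by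
      rcases he with h | h
      · exact ⟨c₁, hc₁e.trans h.symm, hc₁v⟩
      · exact ⟨c₂, hc₂e.trans h.symm, hc₂v⟩
    let ĉ : H.toSemiGraph.Branch := ⟨c, by rw [hce]; exact e.2⟩
    have hEdge : H.toSemiGraph.edgeOf ĉ = e := Subtype.ext hce
    have a1 : H.toSemiGraph.subdivision.Adj V (Sum.inr (Sum.inr ĉ)) := by
      rw [adj_iff']
      exact ⟨by simp [V], Or.inr (NodeRel.branch_vertex ĉ _ (pair_abuts_eq v {e₁, e₂} ĉ hcv))⟩
    have a2 : H.toSemiGraph.subdivision.Adj (Sum.inr (Sum.inr ĉ)) (Sum.inr (Sum.inl e)) := by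
      rw [adj_iff', ← hEdge]
      exact ⟨by simp, Or.inr (NodeRel.edge_branch ĉ)⟩
    exact (a1.reachable).trans a2.reachable
  refine ⟨⟨?_⟩, ?_, ?_, ?_⟩
  · -- connected: every node is reachable from `V`
    rw [SimpleGraph.connected_iff_exists_forall_reachable]
    refine ⟨V, fun z => ?_⟩
    rcases z with w | e | b
    · have hw0 : w.1 ∈ ({v} : Set G.Vertex) := w.2
      have hw1 : w.1 = v := Set.mem_singleton_iff.mp hw0
      have : w = ⟨v, rfl⟩ := Subtype.ext hw1
      subst this; rfl
    · exact reachE e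
    · have a : H.toSemiGraph.subdivision.Adj (Sum.inr (Sum.inl (H.toSemiGraph.edgeOf b))) (Sum.inr (Sum.inr b)) := by
        rw [adj_iff']; exact ⟨by simp, Or.inl (NodeRel.edge_branch b)⟩
      exact (reachE _).trans a.reachable
  · -- one vertex
    change Nat.card ↥({v} : Set G.Vertex) = 1
    rw [Nat.card_coe_set_eq, Set.ncard_singleton]
  · -- two edges
    change Nat.card ↥({e₁, e₂} : Set G.Edge) = 2
    rw [Nat.card_coe_set_eq, Set.ncard_pair hne]
  · -- both edges are open in `H`: at most one of their branches abuts to `v`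
    intro e
    change Nat.card ↥(H.toSemiGraph.verticialPortion e) < 2
    have hsub : (H.toSemiGraph.verticialPortion e).Subsingleton := by
      intro b hb b' hb'
      obtain ⟨hbe, hbs⟩ := hb
      obtain ⟨hb'e, hb's⟩ := hb'
      have h1 : G.abuts b.1 = some v := (pair_abuts_isSome_iff v {e₁, e₂} b).mp hbs
      have h2 : G.abuts b'.1 = some v := (pair_abuts_isSome_iff v {e₁, e₂} b').mp hb's
      have h3 : G.edgeOf b.1 = G.edgeOf b'.1 := by
        have := congrArg Subtype.val (hbe.trans hb'e.symm)
        exact this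
      exact Subtype.ext (branch_unique_of_isAcyclic hG h3 h1 h2)
    rw [Nat.card_coe_set_eq]
    rcases hsub.eq_empty_or_singleton with h | ⟨b, h⟩
    · rw [h, Set.ncard_empty]; omega
    · rw [h, Set.ncard_singleton]; omega

/-- **`Γ` acts trivially on `⟨{v}, {e₁, e₂}⟩`** as soon as it fixes `v`, `e₁`, `e₂` (subdivision acyclic,
`eᵢ` abutting to `v`): the branch of `eᵢ` at `v` is fixed by uniqueness, the other one because `eᵢ` has
exactly two branches and automorphisms are injective on branches. [cite: MochizukiSemiAnbd2006, Lem. 1.8(ii)(c) p.20] -/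
theorem isFixedPointwise_pair (hG : G.subdivision.IsAcyclic) {Γ : Type u} [Group Γ] (ρ : Γ →* Aut G)
    {v : G.Vertex} {e₁ e₂ : G.Edge} {c₁ c₂ : G.Branch} (hc₁e : G.edgeOf c₁ = e₁)
    (hc₁v : G.abuts c₁ = some v) (hc₂e : G.edgeOf c₂ = e₂) (hc₂v : G.abuts c₂ = some v)
    (hv : ∀ γ, (ρ γ).hom.vertexMap v = v) (he₁ : ∀ γ, (ρ γ).hom.edgeMap e₁ = e₁)
    (he₂ : ∀ γ, (ρ γ).hom.edgeMap e₂ = e₂) :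
    (⟨{v}, {e₁, e₂}⟩ : G.Subgraph).IsFixedPointwise ρ := by
  -- a fixed edge `e` with a branch `c` at the fixed vertex `v` has all its branches fixed
  have key : ∀ (γ : Γ) {e : G.Edge} {c : G.Branch}, G.edgeOf c = e → G.abuts c = some v →
      (ρ γ).hom.edgeMap e = e → ∀ b : G.Branch, G.edgeOf b = e → (ρ γ).hom.branchMap b = b := by
    intro γ e c hce hcv he b hbe
    set σ := ρ γ
    have hσc : σ.hom.branchMap c = c := by
      refine branch_unique_of_isAcyclic hG ?_ (by rw [σ.hom.abuts_branchMap c v hcv, hv γ]) hcv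
      rw [σ.hom.edgeOf_branchMap, hce, he]
    by_cases hbc : b = c
    · rw [hbc, hσc]
    · -- `σ b` is a branch of `e` different from `c = σ c`, hence equals `b`
      have h1 : G.edgeOf (σ.hom.branchMap b) = e := by rw [σ.hom.edgeOf_branchMap, hbe, he]
      have h2 : σ.hom.branchMap b ≠ c := by
        intro h
        rw [← hσc] at h
        exact hbc (σ.hom.branchMap_injOn b c (by rw [hbe, hce]) h)
      exact branch_eq_of_ne_of_ne hce h1 hbe h2 hbc
  intro γ
  refine ⟨fun w hw => ?_, fun e he => ?_, fun b hb => ?_⟩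
  · have : w = v := by simpa using hw
    rw [this, hv γ]
  · rcases (show e = e₁ ∨ e = e₂ by simpa using he) with rfl | rfl
    · exact he₁ γ
    · exact he₂ γ
  · rcases (show G.edgeOf b = e₁ ∨ G.edgeOf b = e₂ by simpa using hb) with h | h
    · exact key γ hc₁e hc₁v (he₁ γ) b h
    · exact key γ hc₂e hc₂v (he₂ γ) b h

end Subjoint

/-! ### Lemma 1.8 (ii)(c) -/

/-- **[SemiAnbd] Lemma 1.8 (ii)(c), PROVED as typed**: if a (finite) group acting on a tree fixes three
distinct vertices, it acts trivially on some subjoint. [cite: MochizukiSemiAnbd2006, Lem. 1.8(ii)(c) p.20] -/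
theorem lemma_1_8_ii_c_holds : lemma_1_8_ii_c.{u} := by
  intro G Γ _ _ ρ hG w₁ w₂ w₃ h₁₂ h₂₃ h₁₃ hw₁ hw₂ hw₃
  have hA : G.subdivision.IsAcyclic := hG.isTree.isAcyclic
  have hC : G.subdivision.Connected := hG.isTree.connected
  -- fixed nodes along geodesics, by (ii)(b)
  have fixV : ∀ {a b : G.Vertex} (_ : ∀ γ, (ρ γ).hom.vertexMap a = a) (_ : ∀ γ, (ρ γ).hom.vertexMap b = b)
      (p : G.subdivision.Walk (Sum.inl a) (Sum.inl b)), p.IsPath →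
      ∀ z ∈ p.support, ∀ γ, nodeMap (ρ γ) z = z := by
    intro a b ha hb p hp z hz γ
    exact nodeMap_eq_self_of_isPath hA (ρ γ) (by simp [ha γ]) (by simp [hb γ]) p hp z hz
  -- the subjoint from an interior vertex of a geodesic
  have interior : ∀ {a b : G.Vertex}, (∀ γ, (ρ γ).hom.vertexMap a = a) → (∀ γ, (ρ γ).hom.vertexMap b = b) →
      ∀ (p : G.subdivision.Walk (Sum.inl a) (Sum.inl b)), p.IsPath →
      ∀ (v : G.Vertex) (e₁ e₂ : G.Edge) (c₁ c₂ : G.Branch), e₁ ≠ e₂ → G.edgeOf c₁ = e₁ →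
        G.abuts c₁ = some v → G.edgeOf c₂ = e₂ → G.abuts c₂ = some v → Sum.inl v ∈ p.support →
        Sum.inr (Sum.inl e₁) ∈ p.support → Sum.inr (Sum.inl e₂) ∈ p.support →
        ∃ H : G.Subgraph, H.IsSubjoint ∧ H.IsFixedPointwise ρ := by
    intro a b ha hb p hp v e₁ e₂ c₁ c₂ hne hc₁e hc₁v hc₂e hc₂v hvs he₁s he₂s
    refine ⟨⟨{v}, {e₁, e₂}⟩, isSubjoint_pair hA hne hc₁e hc₁v hc₂e hc₂v,
      isFixedPointwise_pair hA ρ hc₁e hc₁v hc₂e hc₂v ?_ ?_ ?_⟩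
    · intro γ; simpa using fixV ha hb p hp _ hvs γ
    · intro γ; simpa using fixV ha hb p hp _ he₁s γ
    · intro γ; simpa using fixV ha hb p hp _ he₂s γ
  -- geodesics `w₁ → w₂` and `w₂ → w₃`
  obtain ⟨p, hp⟩ := hC.exists_isPath (Sum.inl w₁) (Sum.inl w₂)
  obtain ⟨q, hq⟩ := hC.exists_isPath (Sum.inl w₂) (Sum.inl w₃)
  rcases path_between_vertices_shape h₁₂ p hp with
    ⟨v, e₁, e₂, c₁, c₂, hne, hc₁e, hc₁v, hc₂e, hc₂v, hvs, he₁s, he₂s⟩ | ⟨e, c, c', hcc, hce, hc'e, hcw₁, hc'w₂, hes⟩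
  · exact interior hw₁ hw₂ p hp v e₁ e₂ c₁ c₂ hne hc₁e hc₁v hc₂e hc₂v hvs he₁s he₂s
  rcases path_between_vertices_shape h₂₃ q hq with
    ⟨v, e₁, e₂, c₁, c₂, hne, hc₁e, hc₁v, hc₂e, hc₂v, hvs, he₁s, he₂s⟩ | ⟨f, d, d', hdd, hdf, hd'f, hdw₂, hd'w₃, hfs⟩
  · exact interior hw₂ hw₃ q hq v e₁ e₂ c₁ c₂ hne hc₁e hc₁v hc₂e hc₂v hvs he₁s he₂s
  -- `w₁ –e– w₂ –f– w₃`: the middle vertex `w₂` carries `e ≠ f`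
  have hef : e ≠ f := by
    intro h
    subst h
    -- the edge `e` would abut to the three distinct vertices `w₁`, `w₂`, `w₃` via its two branches
    have hdc' : d = c' := branch_unique_of_isAcyclic hA (hdf.trans hc'e.symm) hdw₂ hc'w₂
    -- `d' ≠ d = c'` and `c ≠ c'` are both "the other branch" of `e`
    have hd'c : d' = c := branch_eq_of_ne_of_ne hc'e hd'f hce (by rw [← hdc']; exact fun h => hdd h.symm) hcc
    have : some w₃ = some w₁ := by rw [← hd'w₃, hd'c, hcw₁]
    exact h₁₃ (by simpa using this.symm)
  refine ⟨⟨{w₂}, {e, f}⟩, isSubjoint_pair hA hef hc'e hc'w₂ hdf hdw₂,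
    isFixedPointwise_pair hA ρ hc'e hc'w₂ hdf hdw₂ hw₂ ?_ ?_⟩
  · intro γ; simpa using fixV hw₁ hw₂ p hp _ hes γ
  · intro γ; simpa using fixV hw₂ hw₃ q hq _ hfs γ

end SemiGraph

end Literature.AnabelianGeometry.SemiGraphs
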